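import Literature.MathematicalPhysics.QuantumFieldTheory.Balaban1983to89.B7Prop4GeneralInduction
import Literature.MathematicalPhysics.QuantumFieldTheory.Balaban1983to89.B7Prop3GeneralLinear

/-!
# Bałaban's averaging operations — B7 Proposition 4 AT A GENERAL REGULAR BACKGROUND, file 2: THE COMPOSITES (127) OF
# THE PAPER'S OWN ONE-STEP MAPS `Q(Ū₀ʲ, ·)`, THE LEVEL REGULARITY FROM PROPOSITION 2, THE k-UNIFORM CONSTANT
# `e^{O(1)2α₀}`, AND PROPOSITION 4 (130)–(135) CONDITIONAL ON PROPOSITION 3 AT A GENERAL BACKGROUND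
# (`B7Prop4GeneralLevels`)

CITATION HEADER (lean-in-tree rule).  Audit cell `pub-balaban`, sub-cell `t4`, NE7c ROUND-2 crew seat
`b2b-balaban-t4-ne7c-formalise-leaf-10` gen 8; owner table `t4/b2b-balaban-t4-ne7c-p1/LEAVES-NE7c-P1.md` v2.3 row **S56**
«[B7] PROPOSITION 4 (127)–(136) AT A GENERAL REGULAR BACKGROUND — k-UNIFORM» (WALL §3 W-a: `Cf` = [Balaban1985Variational]
(44)'s `C_j` = this Prop. 4's `C_k`), file 2 of the row (file 1 = `B7Prop4GeneralInduction` p219540, the abstract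
induction; file 3 = the discharge of this file's three Prop. 3 hypotheses by row S55's theorem, BY NAME).  Source:
T. Bałaban, *Averaging operations for lattice gauge theories*, Commun. Math. Phys. **98**, 17–51 (1985)
[Balaban1985Averaging], Sect. D pp. 36–39 = PDF pp. 20–23, renders
`b2b-balaban-ref1/pages/1985-cmp98-averaging/1985-cmp98-averaging-p020…p023-x2.png` READ AS IMAGES by this seat.
Companions REUSED BY NAME, none modified: b07's `B7Prop2Explicit` (`avgIter` = Ū₀ʲ (43), `pdev`, `AvgClosed`,
`prop2_explicit_lt_two`, `avgIter_mem`, `C0`, `c2'`), `B7Eq92Concrete` (`dbavgCov` (89), `dbavgCovIter` (90)/(91),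
`avgIter_one`), `B7Prop4Flat` (`logIter`, `logIter_succ`), leaf-05-g6's row-S55 objects `B7Prop3GeneralLinear.Qcov` (121)
/ `linQcov` (122) / `Qcov_one_left`, and file 1's `prop4_induction`, `prod_one_add_le_exp_sum`, `geom_sum_le_two`.

THE PRINTED TEXT (quoted from the renders; see file 1 for (128)–(133) in full).  p. 37: «(1/i) log U̿₁^k as a function of
(1/i) log U₁ is a composition of the functions Q(U₀, ·), Q(Ū₀, ·), …, Q(Ū₀^{k−2}, ·), Q(Ū₀^{k−1}, ·). (127) We assume
that U₀ satisfies the assumptions of Proposition 2 and U₁ = e^{iηA}, |A| < α₁. Then by this proposition the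
configurations Ū₀^j for j < k satisfy the assumptions of Proposition 3 for V₀ = Ū₀^j if α₀L^{2j}η² + 2C₀(α₀L^{2j}η²)² ≦
2α₀L^{2j}η² < α₀ ≦ c₃.»; p. 38: «denoting Q_{j+1}(U₀, ηA) = Q(Ū₀ʲ, Q_j(U₀, ηA)), Q_{j+1}(U₀) = Q(Ū₀ʲ)Q_j(U₀)»; (133):
«|Q_k(U₀, ηA) − Q_k(U₀)A| < e^{O(1)(1+L^{−2}+…+L^{−2(k−1)})α₀}·4C₁(1 + L^{−1} + … + L^{−(k−1)})α₁² < e^{O(1)2α₀}8C₁α₁² =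
C₂α₁².»; Proposition 4 (pp. 38–39): «Q_k(U₀, ηA) = Q_k(U₀)A + C_k(U₀, A), (134) and |C_k(U₀, A)| ≦ C₂|A|² < C₂α₁².
(135)», «The constants C₂, c₄ are independent of k, C₂ depends on d and c₄ depends on d and L.»  One-step input, p. 36:
«Q(V₀, A, c) = L(Q(V₀)A)_c + C(V₀, A, c). (122)», «|C(V₀, A, c)| ≦ C₁L²|A|² (123)», «|(Q(V₀)A)_c| ≦ |A| + O(1)L²α₀|A|
(126)».  Proposition 2 (54) p. 26: «|Ū^k(∂p) − 1| < α₀ + 2C₀α₀² < 2α₀».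

DICTIONARY and TYPING (b07 conventions: `i`, `η` absorbed — `b` plays `ηα₁`, `L^jb` plays `L^jηα₁`; every level read
on the unit lattice `ℤ^d` by `rescale`; `𝔸` a complete normed `ℂ`-algebra).  «Q_j(U₀, ηA)» ↦ `logCovIter L U₀ B j`
(`logCovIter (j+1) (z, κ) = Qcov L (Ū₀ʲ) (logCovIter j) (Lz, κ)`, `Ū₀ʲ = avgIter L U₀ j`; print's recursion of p. 38
with the one-step map (121) `Qcov` of `B7Prop3GeneralLinear` = `(1/i) log V̿₁[·]` at the background `Ū₀ʲ`, (89)/(91));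
the un-normalised composed linear part «L^jη·Q_j(U₀)A» ↦ `linCovIter L U₀ B j` (same recursion with (122)'s `linQcov`);
the level-`j` regularity «2α₀L^{2j}η²» ↦ `2α₀(L^j/L^k)²` for `pdev (avgIter L U₀ j)` (§2, from Prop. 2 applied with
`α₀(L^j/L^k)²` in place of `α₀` — print's remark after (127)); «e^{O(1)2α₀}» ↦ `exp (4cα₀)` where `c` is the `O(1)` of
(126) (§3: `∏_{j<k}(1 + c·L²·2α₀(L^j/L^k)²) ≤ exp(2cα₀·Σ_{m<k}L^{−2m}) ≤ exp(4cα₀)`, `L ≥ 2`).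

WHAT THIS FILE PROVES (kernel, 0 sorry; the THREE facts of Proposition 3 at a general regular background are
HYPOTHESES — `h3rem` = (123), `h3lin` = (126) WITH LEADING COEFFICIENT EXACTLY `L`, `h3sub` = additivity of the linear
part — each quantified over backgrounds `V₀` with values in an `AvgClosed` group `G` and `pdev V₀ < β ≤ βmax`; row S55
proves them for `Qcov`/`linQcov`, file 3 discharges them BY NAME):
* §1 `logCovIter`, `linCovIter` + `_zero`/`_succ` (rfl) + `logCovIter_one_left : logCovIter L 1 B = B7Prop4Flat.logIter
  L B` (flat reduction: `avgIter_one`, `Qcov_one_left`).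
* §2 `level_regularity` — for `U₀` as in Prop. 2 (`pdev U₀ < α₀·L^{−2k}`, `C₀α₀ ≤ 1/3`, `2α₀ ≤ c₂′`), EVERY level
  `j ≤ k` has `pdev (Ū₀ʲ) < 2α₀(L^j/L^k)²` and `Ū₀ʲ` is `G`-valued (`prop2_explicit_lt_two` / `avgIter_mem` at the
  smaller parameter `α₀(L^j/L^k)² ≤ α₀`).
* §3 `levelFactors_prod_le_exp` — «e^{O(1)(L^{2j}+…+L²)η²α₀} ≤ e^{O(1)2α₀}»: `∏_{j<k}(1 + cL²·2α₀(L^j/L^k)²) ≤ e^{4cα₀}`.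
* §4 **`prop4_general_of_prop3`** — Prop. 4's bounds at a general regular background, k-UNIFORM, CONDITIONAL on the
  three Prop. 3 hypotheses: for `U₀` as in Prop. 2, `sup‖B‖ ≤ b`, `e^{4cα₀}(1 + 8C₁L^kb) ≤ 2` and `2L^jb ≤ c₃` (`j < k`):
  every `j ≤ k` satisfies (130) `‖Q_j − L^jηQ_jA‖ ≤ 8C₁e^{4cα₀}(L^jb)²` and (131) `‖Q_j‖ ≤ 2L^jb`; at `j = k` this is
  (134)–(135) with `C₂ = e^{4cα₀}·8C₁` INDEPENDENT OF `k` (`prop4_general_remainder_at_k`).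
ABSOLUTE-RULE LEDGER.  Hypotheses = the three Prop. 3 facts at a general background (row S55's theorems-to-be, stated
in the SHAPES journalled l.14041) + Prop. 2's printed smallness on `U₀` + the displayed smallness on `b`; nothing of the
manuscript is cited as a fact; Prop. 2 enters through b07's KERNEL theorem `prop2_explicit_lt_two`.  NOT DONE HERE: the
proofs of (123)/(126)/additivity (S55), the analyticity clause (file 3 via file 1's `prop4_induction_analyticAt` once
S55's parametrised analyticity lands), (136), the identification `U̿₁ʲ = exp(logCovIter j)` ((i) of the flat file —
needs S55's `‖V̿₁ − 1‖ < 1`).  HONEST (cell): W-a stays TYPE; even when file 3 closes, only B11's CITED INPUT [4] Prop. 4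
becomes kernel, not its sectioned/V-uniform use in B11; NE7c NOT PROVED; spine PROVED 0/9; NOT infinite volume, NOT mass
gap, NOT Clay.  HONEST DEPENDENCY: continuum YM on T⁴ ⇐ BetaPertH ∧ nine spine estimates (0/9 proved); BetaPertH ⇐ (D1)
∧ (D4) ∧ CAP+tail; G-an2-4 gates asym, D1 and NE2/3/4.
-/

noncomputable section

open scoped BigOperators
open Finset

namespace Literature.MathematicalPhysics.QuantumFieldTheory.Balaban1983to89.B7Prop4GeneralLevels

open B7Prop1Explicit B7Prop2Explicit B7Prop3Flat B7Prop4Flat B7Eq92Concrete B7Prop3GeneralLinear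
  B7Prop4GeneralInduction MatrixLog

variable {d : ℕ} {𝔸 : Type*} [NormedRing 𝔸] [NormedAlgebra ℂ 𝔸] [CompleteSpace 𝔸]

/-! ## §1 The composites (127) of the one-step maps at the level backgrounds `Ū₀ʲ` -/

section Composites

/-- **«Q_j(U₀, ηA)», the composition of the first `j` functions (127)** at a GENERAL background — p. 38: «denoting
Q_{j+1}(U₀, ηA) = Q(Ū₀ʲ, Q_j(U₀, ηA))» —, each factor being the one-step map (121) `Qcov` of `B7Prop3GeneralLinear`
(`(1/i) log V̿₁` at the background `Ū₀ʲ = avgIter L U₀ j`, (89)/(91)), read on the unit lattice after `j` rescalings: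
`logCovIter L U₀ B 0 = B`, `logCovIter L U₀ B (j+1) (z, κ) = Q(Ū₀ʲ, logCovIter L U₀ B j)` at the `L`-bond `⟨Lz, Lz + Le_κ⟩`.
At `U₀ = 1` it is `B7Prop4Flat.logIter` (`logCovIter_one_left`). [cite: Balaban1985Averaging, (127) p.37, p.38 (before (133)), (121) p.36] -/
def logCovIter (L : ℕ) (U₀ : B7Prop1Explicit.Site d → Fin d → 𝔸ˣ) (B : B7Prop1Explicit.Site d → Fin d → 𝔸) :
    ℕ → B7Prop1Explicit.Site d → Fin d → 𝔸
  | 0 => B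
  | j + 1 => fun z κ => Qcov L (avgIter L U₀ j) (logCovIter L U₀ B j) ((L : ℤ) • z) κ

/-- **«L^jη·Q_j(U₀)A», the composition of the linear parts** — p. 38: «Q_{j+1}(U₀) = Q(Ū₀ʲ)Q_j(U₀)» —, un-normalised,
each factor being (122)'s linear part `linQcov` of `B7Prop3GeneralLinear` at the background `Ū₀ʲ`.
[cite: Balaban1985Averaging, p.38 (before (133)), (122) p.36] -/
def linCovIter (L : ℕ) (U₀ : B7Prop1Explicit.Site d → Fin d → 𝔸ˣ) (B : B7Prop1Explicit.Site d → Fin d → 𝔸) :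
    ℕ → B7Prop1Explicit.Site d → Fin d → 𝔸
  | 0 => B
  | j + 1 => fun z κ => linQcov L (avgIter L U₀ j) (linCovIter L U₀ B j) ((L : ℤ) • z) κ

variable (L : ℕ) (U₀ : B7Prop1Explicit.Site d → Fin d → 𝔸ˣ) (B : B7Prop1Explicit.Site d → Fin d → 𝔸)

/-- `Q_0(U₀, ηA) = ηA`. [cite: Balaban1985Averaging, (127) p.37] -/
@[simp] theorem logCovIter_zero : logCovIter L U₀ B 0 = B := rfl

/-- «Q_{j+1}(U₀, ηA) = Q(Ū₀ʲ, Q_j(U₀, ηA))», bondwise. [cite: Balaban1985Averaging, p.38 (before (133))] -/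
theorem logCovIter_succ (j : ℕ) (z : B7Prop1Explicit.Site d) (κ : Fin d) :
    logCovIter L U₀ B (j + 1) z κ = Qcov L (avgIter L U₀ j) (logCovIter L U₀ B j) ((L : ℤ) • z) κ := rfl

/-- `L^0η·Q_0(U₀)A = ηA`. [cite: Balaban1985Averaging, (127) p.37] -/
@[simp] theorem linCovIter_zero : linCovIter L U₀ B 0 = B := rfl

/-- «Q_{j+1}(U₀) = Q(Ū₀ʲ)Q_j(U₀)», bondwise (un-normalised). [cite: Balaban1985Averaging, p.38 (before (133))] -/
theorem linCovIter_succ (j : ℕ) (z : B7Prop1Explicit.Site d) (κ : Fin d) :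
    linCovIter L U₀ B (j + 1) z κ = linQcov L (avgIter L U₀ j) (linCovIter L U₀ B j) ((L : ℤ) • z) κ := rfl

/-- **flat reduction**: at `U₀ = 1` every `Ū₀ʲ = 1` (`avgIter_one`, (42) of the unit configuration) and the composite
is `B7Prop4Flat.logIter` (`Qcov_one_left`). [cite: Balaban1985Averaging, (127) p.37, (121) p.36] -/
theorem logCovIter_one_left : ∀ j : ℕ, logCovIter L (1 : B7Prop1Explicit.Site d → Fin d → 𝔸ˣ) B j = logIter L B j
  | 0 => rfl
  | j + 1 => by
    funext z κ
    rw [logCovIter_succ, logIter_succ, avgIter_one, Qcov_one_left, logCovIter_one_left j]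

end Composites

/-! ## §2 The level backgrounds `Ū₀ʲ` are regular with parameter `2α₀(L^j/L^k)²` (Proposition 2 at every level) -/

section Levels

variable [NormOneClass 𝔸]

/-- **p. 37, after (127): «by this proposition the configurations Ū₀ʲ for j < k satisfy the assumptions of
Proposition 3 for V₀ = Ū₀ʲ if α₀L^{2j}η² + 2C₀(α₀L^{2j}η²)² ≦ 2α₀L^{2j}η² < α₀ ≦ c₃»** — PROVED from b07's kernel
Proposition 2: for `U₀` `G`-valued with `pdev U₀ < α₀·L^{−2k}` («|U(∂p) − 1| < α₀η²», `η = L^{−k}`), `C₀α₀ ≤ 1/3`,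
`2α₀ ≤ c₂′`, EVERY level `j ≤ k` has `pdev (Ū₀ʲ) < 2α₀(L^j/L^k)²` and `Ū₀ʲ` is `G`-valued (`prop2_explicit_lt_two` and
`avgIter_mem` with `k := j` and the parameter `α₀(L^j/L^k)² ≤ α₀`). [cite: Balaban1985Averaging, p.37 (after (127)), Prop. 2 (54) p.26] -/
theorem level_regularity (L : ℕ) (hL : 2 ≤ L) {G : Subgroup 𝔸ˣ} (hG : AvgClosed d L G) (k : ℕ)
    (U₀ : B7Prop1Explicit.Site d → Fin d → 𝔸ˣ) (hU₀ : ∀ x κ, U₀ x κ ∈ G) {α₀ : ℝ} (hα : 0 < α₀)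
    (hα3 : C0 d * α₀ ≤ 1 / 3) (hα2 : 2 * α₀ ≤ c2' d L) (h52 : pdev U₀ < α₀ * (((L : ℝ) ^ k)⁻¹) ^ 2) :
    ∀ j ≤ k, pdev (avgIter L U₀ j) < 2 * (α₀ * ((L : ℝ) ^ j * ((L : ℝ) ^ k)⁻¹) ^ 2) ∧
      ∀ x κ, avgIter L U₀ j x κ ∈ G := by
  intro j hj
  have hL1 : (1 : ℝ) ≤ L := by exact_mod_cast le_trans (by norm_num) hL
  have hLk : (0 : ℝ) < (L : ℝ) ^ k := by positivity
  have hLj : (0 : ℝ) < (L : ℝ) ^ j := by positivity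
  set α' : ℝ := α₀ * ((L : ℝ) ^ j * ((L : ℝ) ^ k)⁻¹) ^ 2 with hα'
  have hratio : (L : ℝ) ^ j * ((L : ℝ) ^ k)⁻¹ ≤ 1 := by
    rw [mul_inv_le_iff₀ hLk, one_mul]; exact pow_le_pow_right₀ hL1 hj
  have hratio0 : 0 ≤ (L : ℝ) ^ j * ((L : ℝ) ^ k)⁻¹ := by positivity
  have hα'le : α' ≤ α₀ := by
    have h1 : ((L : ℝ) ^ j * ((L : ℝ) ^ k)⁻¹) ^ 2 ≤ 1 := by
      rw [← one_pow 2]; exact pow_le_pow_left₀ hratio0 hratio 2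
    calc α' = α₀ * ((L : ℝ) ^ j * ((L : ℝ) ^ k)⁻¹) ^ 2 := rfl
      _ ≤ α₀ * 1 := mul_le_mul_of_nonneg_left h1 hα.le
      _ = α₀ := mul_one _
  have hα'pos : 0 < α' := by positivity
  have hα3' : C0 d * α' ≤ 1 / 3 := (mul_le_mul_of_nonneg_left hα'le (C0_pos d).le).trans hα3
  have hα2' : 2 * α' ≤ c2' d L := by linarith
  have h52' : pdev U₀ < α' * (((L : ℝ) ^ j)⁻¹) ^ 2 := by
    have heq : α' * (((L : ℝ) ^ j)⁻¹) ^ 2 = α₀ * (((L : ℝ) ^ k)⁻¹) ^ 2 := by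
      rw [hα']; field_simp
    rwa [heq]
  exact ⟨prop2_explicit_lt_two L hL hG j U₀ hU₀ hα'pos hα3' hα2' h52',
    avgIter_mem L hL hG j U₀ hU₀ hα'pos hα3' hα2' h52' j le_rfl⟩

end Levels

/-! ## §3 The k-uniform constant: «e^{O(1)(L^{2j}+…+L²)η²α₀} ≤ e^{O(1)2α₀}» -/

section Constant

/-- partial products of factors `≥ 1` are monotone. [folklore] -/
private theorem prod_range_mono (κ : ℕ → ℝ) (hκ : ∀ i, 0 ≤ κ i) {m n : ℕ} (h : m ≤ n) :
    ∏ i ∈ range m, (1 + κ i) ≤ ∏ i ∈ range n, (1 + κ i) := by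
  induction n, h using Nat.le_induction with
  | base => exact le_rfl
  | succ n _ ih =>
    rw [prod_range_succ]
    have h1 : 0 ≤ ∏ i ∈ range n, (1 + κ i) := prod_nonneg fun i _ => by linarith [hκ i]
    have h2 : 1 ≤ 1 + κ n := by linarith [hκ n]
    nlinarith

/-- the geometric sum of the level exponents: `Σ_{j<k} L²·(L^j/L^k)² = Σ_{m<k} (L^{−2})^m ≤ 2` for `L ≥ 2` (print's
«(L^{2j}+…+L⁴+L²)η² = 1 + L^{−2} + … ≤ …», bounded by `2` as in «e^{O(1)2α₀}»). [cite: Balaban1985Averaging, (130)–(131) p.38, (133) p.38] -/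
theorem sum_level_weights_le_two {L : ℝ} (hL : 2 ≤ L) (k : ℕ) :
    ∑ j ∈ range k, L ^ 2 * (L ^ j * (L ^ k)⁻¹) ^ 2 ≤ 2 := by
  have hL0 : 0 < L := by linarith
  have hr0 : 0 ≤ (L ^ 2)⁻¹ := by positivity
  have hr : (L ^ 2)⁻¹ ≤ 1 / 2 := by
    rw [inv_le_comm₀ (by positivity) (by norm_num)]
    nlinarith
  -- term j equals (L^{-2})^{k-1-j}; reflect the sum
  have hterm : ∀ j ∈ range k, L ^ 2 * (L ^ j * (L ^ k)⁻¹) ^ 2 = ((L ^ 2)⁻¹) ^ (k - 1 - j) := by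
    intro j hj
    have hjk : j < k := mem_range.1 hj
    have hk : k = (k - 1 - j) + j + 1 := by omega
    have hLne : L ≠ 0 := hL0.ne'
    rw [inv_pow, ← pow_mul]
    conv_lhs => rw [hk]
    field_simp
    ring_nf
  rw [sum_congr rfl hterm, sum_range_reflect (fun m => ((L ^ 2)⁻¹) ^ m) k]
  exact geom_sum_le_two hr0 hr k

/-- **«e^{O(1)(L^{2j}+…+L²)η²α₀} ≤ e^{O(1)2α₀}»**: with the level-`j` increment `κ_j = c·L²·2α₀(L^j/L^k)²` (the `O(1)L²α₀`
of (126) at the regularity `2α₀(L^j/L^k)²` of §2), `∏_{j<k}(1 + κ_j) ≤ exp(4cα₀)` — INDEPENDENT OF `k`.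
[cite: Balaban1985Averaging, (131) p.38, (133) p.38, p.39] -/
theorem levelFactors_prod_le_exp {L c α₀ : ℝ} (hL : 2 ≤ L) (hc : 0 ≤ c) (hα : 0 ≤ α₀) (k : ℕ) :
    ∏ j ∈ range k, (1 + c * L ^ 2 * (2 * (α₀ * (L ^ j * (L ^ k)⁻¹) ^ 2))) ≤ Real.exp (4 * c * α₀) := by
  have hκ : ∀ j, 0 ≤ c * L ^ 2 * (2 * (α₀ * (L ^ j * (L ^ k)⁻¹) ^ 2)) := fun j => by positivity
  refine (prod_one_add_le_exp_sum _ hκ k).trans (Real.exp_le_exp.2 ?_)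
  have hsum : ∑ j ∈ range k, c * L ^ 2 * (2 * (α₀ * (L ^ j * (L ^ k)⁻¹) ^ 2))
      = 2 * c * α₀ * ∑ j ∈ range k, L ^ 2 * (L ^ j * (L ^ k)⁻¹) ^ 2 := by
    rw [mul_sum]; refine sum_congr rfl fun j _ => by ring
  rw [hsum]
  have := sum_level_weights_le_two hL k
  have h0 : 0 ≤ 2 * c * α₀ := by positivity
  nlinarith

end Constant

/-! ## §4 Proposition 4 at a general regular background, conditional on Proposition 3 -/

section Prop4

variable [NormOneClass 𝔸]

/-- **PROPOSITION 4 (130)–(135) AT A GENERAL REGULAR BACKGROUND, k-UNIFORM — CONDITIONAL ON PROPOSITION 3.**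
HYPOTHESES ON THE ONE-STEP MAP (row S55's theorems, for backgrounds `V₀` with values in the `AvgClosed` group `G` and
`pdev V₀ < β ≤ βmax`): `h3rem` = (123) «|C(V₀, A, c)| ≦ C₁L²|A|²» for `sup‖A‖ ≤ a ≤ c₃`; `h3lin` = (126)
«|(Q(V₀)A)_c| ≦ |A| + O(1)L²α₀|A|», un-normalised: `‖linQcov L V₀ A‖ ≤ L(1 + cL²β)·a` (leading coefficient EXACTLY `L`);
`h3sub` = additivity of the linear part.  HYPOTHESES ON THE DATA (printed): `U₀` `G`-valued with `pdev U₀ < α₀L^{−2k}`,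
`C₀α₀ ≤ 1/3`, `2α₀ ≤ c₂′` (Prop. 2), `2α₀ ≤ βmax`; `sup‖B‖ ≤ b`; smallness `e^{4cα₀}(1 + 8C₁L^kb) ≤ 2` («e^{O(1)2α₀}(1 +
8C₁α₁)α₁ < 2α₁», (131)) and `2L^jb ≤ c₃` for `j < k` («α₁ ≦ ½c₃»).  CONCLUSION for every `j ≤ k`: (130)
`‖Q_j(U₀, ηB) − L^jηQ_j(U₀)B‖ ≤ 8C₁e^{4cα₀}(L^jb)²` and (131) = (161) `‖Q_j(U₀, ηB)‖ ≤ 2L^jb`, bondwise, for the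
composites `logCovIter`/`linCovIter` of the paper's maps — file 1's `prop4_induction` with `κ_j = cL²·2α₀(L^j/L^k)²`,
`P = e^{4cα₀}` (§3), the level regularity of §2. [cite: Balaban1985Averaging, (130)–(131) p.38, (133)–(135) pp.38–39, (161) p.42] -/
theorem prop4_general_of_prop3 (L : ℕ) (hL : 2 ≤ L) {G : Subgroup 𝔸ˣ} (hG : AvgClosed d L G)
    {C₁ c₃ c βmax : ℝ} (hC₁ : 0 ≤ C₁) (hc : 0 ≤ c)
    (h3rem : ∀ (V₀ : B7Prop1Explicit.Site d → Fin d → 𝔸ˣ) (β : ℝ), (∀ x κ, V₀ x κ ∈ G) → 0 ≤ β → pdev V₀ < β →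
      β ≤ βmax → ∀ (A : B7Prop1Explicit.Site d → Fin d → 𝔸) (a : ℝ), 0 ≤ a → a ≤ c₃ → (∀ x κ, ‖A x κ‖ ≤ a) →
      ∀ q κ, ‖Qcov L V₀ A q κ - linQcov L V₀ A q κ‖ ≤ C₁ * (L : ℝ) ^ 2 * a ^ 2)
    (h3lin : ∀ (V₀ : B7Prop1Explicit.Site d → Fin d → 𝔸ˣ) (β : ℝ), (∀ x κ, V₀ x κ ∈ G) → 0 ≤ β → pdev V₀ < β →
      β ≤ βmax → ∀ (A : B7Prop1Explicit.Site d → Fin d → 𝔸) (a : ℝ), 0 ≤ a → (∀ x κ, ‖A x κ‖ ≤ a) →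
      ∀ q κ, ‖linQcov L V₀ A q κ‖ ≤ L * (1 + c * (L : ℝ) ^ 2 * β) * a)
    (h3sub : ∀ (V₀ : B7Prop1Explicit.Site d → Fin d → 𝔸ˣ) (β : ℝ), (∀ x κ, V₀ x κ ∈ G) → 0 ≤ β → pdev V₀ < β →
      β ≤ βmax → ∀ (A A' : B7Prop1Explicit.Site d → Fin d → 𝔸) (q : B7Prop1Explicit.Site d) (κ : Fin d),
      linQcov L V₀ (A - A') q κ = linQcov L V₀ A q κ - linQcov L V₀ A' q κ)
    (k : ℕ) (U₀ : B7Prop1Explicit.Site d → Fin d → 𝔸ˣ) (hU₀ : ∀ x κ, U₀ x κ ∈ G) {α₀ : ℝ} (hα : 0 < α₀)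
    (hα3 : C0 d * α₀ ≤ 1 / 3) (hα2 : 2 * α₀ ≤ c2' d L) (h52 : pdev U₀ < α₀ * (((L : ℝ) ^ k)⁻¹) ^ 2)
    (hβmax : 2 * α₀ ≤ βmax)
    (B : B7Prop1Explicit.Site d → Fin d → 𝔸) {b : ℝ} (hb : 0 ≤ b) (hB : ∀ x κ, ‖B x κ‖ ≤ b)
    (hsmall : Real.exp (4 * c * α₀) * (1 + 8 * C₁ * ((L : ℝ) ^ k * b)) ≤ 2)
    (hc₃ : ∀ j < k, 2 * ((L : ℝ) ^ j * b) ≤ c₃) :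
    ∀ j ≤ k,
      (∀ z κ, ‖logCovIter L U₀ B j z κ - linCovIter L U₀ B j z κ‖
        ≤ 8 * C₁ * Real.exp (4 * c * α₀) * ((L : ℝ) ^ j * b) ^ 2) ∧
      (∀ z κ, ‖logCovIter L U₀ B j z κ‖ ≤ 2 * ((L : ℝ) ^ j * b)) := by
  have hLr : (2 : ℝ) ≤ L := by exact_mod_cast hL
  -- the level data
  set κ : ℕ → ℝ := fun j => c * (L : ℝ) ^ 2 * (2 * (α₀ * ((L : ℝ) ^ j * ((L : ℝ) ^ k)⁻¹) ^ 2)) with hκdef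
  have hκ0 : ∀ j, 0 ≤ κ j := fun j => by positivity
  have hreg := level_regularity L hL hG k U₀ hU₀ hα hα3 hα2 h52
  have hβ0 : ∀ j, 0 ≤ 2 * (α₀ * ((L : ℝ) ^ j * ((L : ℝ) ^ k)⁻¹) ^ 2) := fun j => by positivity
  have hβle : ∀ j ≤ k, 2 * (α₀ * ((L : ℝ) ^ j * ((L : ℝ) ^ k)⁻¹) ^ 2) ≤ βmax := by
    intro j hj
    have hL1 : (1 : ℝ) ≤ L := by linarith
    have hLk : (0 : ℝ) < (L : ℝ) ^ k := by positivity
    have hratio : (L : ℝ) ^ j * ((L : ℝ) ^ k)⁻¹ ≤ 1 := by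
      rw [mul_inv_le_iff₀ hLk, one_mul]; exact pow_le_pow_right₀ hL1 hj
    have h1 : ((L : ℝ) ^ j * ((L : ℝ) ^ k)⁻¹) ^ 2 ≤ 1 := by
      rw [← one_pow 2]; exact pow_le_pow_left₀ (by positivity) hratio 2
    nlinarith [mul_le_mul_of_nonneg_left h1 hα.le]
  -- file 1's induction
  have hmain := prop4_induction (σ := B7Prop1Explicit.Site d) (τ := Fin d) (𝔸 := 𝔸) (c₃ := c₃)
    (P := Real.exp (4 * c * α₀)) hLr hC₁ (k := k) κ hκ0
    (fun j A z κ' => Qcov L (avgIter L U₀ j) A ((L : ℤ) • z) κ')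
    (fun j A z κ' => linQcov L (avgIter L U₀ j) A ((L : ℤ) • z) κ')
    (fun j hj A A' => funext fun z => funext fun κ' =>
      h3sub _ _ (hreg j hj.le).2 (hβ0 j) (hreg j hj.le).1 (hβle j hj.le) A A' _ κ')
    (fun j hj A r hr hrc hA z κ' =>
      h3rem _ _ (hreg j hj.le).2 (hβ0 j) (hreg j hj.le).1 (hβle j hj.le) A r hr hrc hA _ κ')
    (fun j hj A r hr hA z κ' => by
      have h := h3lin _ _ (hreg j hj.le).2 (hβ0 j) (hreg j hj.le).1 (hβle j hj.le) A r hr hA ((L : ℤ) • z) κ'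
      have hκj : (L : ℝ) * (1 + c * (L : ℝ) ^ 2 * (2 * (α₀ * ((L : ℝ) ^ j * ((L : ℝ) ^ k)⁻¹) ^ 2))) * r
          = L * (1 + κ j) * r := by rw [hκdef]
      rw [← hκj]; exact h)
    B hb hB (logCovIter L U₀ B) (linCovIter L U₀ B) rfl
    (fun j _ => funext fun z => funext fun κ' => logCovIter_succ L U₀ B j z κ') rfl
    (fun j _ => funext fun z => funext fun κ' => linCovIter_succ L U₀ B j z κ')
    (levelFactors_prod_le_exp hLr hc hα.le k) hsmall hc₃
  intro j hj
  obtain ⟨hE, -, hT⟩ := hmain j hj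
  refine ⟨fun z κ' => (hE z κ').trans ?_, hT⟩
  have hPj : ∏ i ∈ range j, (1 + κ i) ≤ Real.exp (4 * c * α₀) :=
    (prod_range_mono κ hκ0 hj).trans (levelFactors_prod_le_exp hLr hc hα.le k)
  have h8 : 0 ≤ 8 * C₁ := by positivity
  exact mul_le_mul_of_nonneg_right (mul_le_mul_of_nonneg_left hPj h8) (sq_nonneg _)

/-- **(134)–(135) at `j = k` with `C₂ = e^{4cα₀}·8C₁` INDEPENDENT OF `k`** («|C_k(U₀, A)| ≦ C₂|A|²», «C₂ = e^{O(1)2α₀}8C₁»,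
«The constants C₂, c₄ are independent of k»), conditional on Proposition 3 as above: the remainder
`C_k(U₀, B) := Q_k(U₀, ηB) − L^kηQ_k(U₀)B` of the paper's composite satisfies `‖C_k‖ ≤ (8C₁e^{4cα₀})·(L^kb)²`.
[cite: Balaban1985Averaging, (133)–(135) pp.38–39] -/
theorem prop4_general_remainder_at_k (L : ℕ) (hL : 2 ≤ L) {G : Subgroup 𝔸ˣ} (hG : AvgClosed d L G)
    {C₁ c₃ c βmax : ℝ} (hC₁ : 0 ≤ C₁) (hc : 0 ≤ c)
    (h3rem : ∀ (V₀ : B7Prop1Explicit.Site d → Fin d → 𝔸ˣ) (β : ℝ), (∀ x κ, V₀ x κ ∈ G) → 0 ≤ β → pdev V₀ < β →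
      β ≤ βmax → ∀ (A : B7Prop1Explicit.Site d → Fin d → 𝔸) (a : ℝ), 0 ≤ a → a ≤ c₃ → (∀ x κ, ‖A x κ‖ ≤ a) →
      ∀ q κ, ‖Qcov L V₀ A q κ - linQcov L V₀ A q κ‖ ≤ C₁ * (L : ℝ) ^ 2 * a ^ 2)
    (h3lin : ∀ (V₀ : B7Prop1Explicit.Site d → Fin d → 𝔸ˣ) (β : ℝ), (∀ x κ, V₀ x κ ∈ G) → 0 ≤ β → pdev V₀ < β →
      β ≤ βmax → ∀ (A : B7Prop1Explicit.Site d → Fin d → 𝔸) (a : ℝ), 0 ≤ a → (∀ x κ, ‖A x κ‖ ≤ a) →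
      ∀ q κ, ‖linQcov L V₀ A q κ‖ ≤ L * (1 + c * (L : ℝ) ^ 2 * β) * a)
    (h3sub : ∀ (V₀ : B7Prop1Explicit.Site d → Fin d → 𝔸ˣ) (β : ℝ), (∀ x κ, V₀ x κ ∈ G) → 0 ≤ β → pdev V₀ < β →
      β ≤ βmax → ∀ (A A' : B7Prop1Explicit.Site d → Fin d → 𝔸) (q : B7Prop1Explicit.Site d) (κ : Fin d),
      linQcov L V₀ (A - A') q κ = linQcov L V₀ A q κ - linQcov L V₀ A' q κ)
    (k : ℕ) (U₀ : B7Prop1Explicit.Site d → Fin d → 𝔸ˣ) (hU₀ : ∀ x κ, U₀ x κ ∈ G) {α₀ : ℝ} (hα : 0 < α₀)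
    (hα3 : C0 d * α₀ ≤ 1 / 3) (hα2 : 2 * α₀ ≤ c2' d L) (h52 : pdev U₀ < α₀ * (((L : ℝ) ^ k)⁻¹) ^ 2)
    (hβmax : 2 * α₀ ≤ βmax)
    (B : B7Prop1Explicit.Site d → Fin d → 𝔸) {b : ℝ} (hb : 0 ≤ b) (hB : ∀ x κ, ‖B x κ‖ ≤ b)
    (hsmall : Real.exp (4 * c * α₀) * (1 + 8 * C₁ * ((L : ℝ) ^ k * b)) ≤ 2)
    (hc₃ : ∀ j < k, 2 * ((L : ℝ) ^ j * b) ≤ c₃) :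
    ∀ z κ, ‖logCovIter L U₀ B k z κ - linCovIter L U₀ B k z κ‖
      ≤ (8 * C₁ * Real.exp (4 * c * α₀)) * ((L : ℝ) ^ k * b) ^ 2 :=
  (prop4_general_of_prop3 L hL hG hC₁ hc h3rem h3lin h3sub k U₀ hU₀ hα hα3 hα2 h52 hβmax B hb hB hsmall hc₃ k
    le_rfl).1

end Prop4

end Literature.MathematicalPhysics.QuantumFieldTheory.Balaban1983to89.B7Prop4GeneralLevels

end
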